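import Summits.AtomisticToContinuum.BoseEinsteinCondensation.Theorems.BECCutLineWeakDisorderTwoReplicaTransienceBoundFreeGas
import Summits.AtomisticToContinuum.BoseEinsteinCondensation.Theorems.BECCutLineWeakDisorderTwoReplicaTransienceBoundSurvivalFloor
import Literature.MathematicalPhysics.QuantumManyBody.GroundStateFeynmanKacCutLine
import Literature.MathematicalPhysics.QuantumManyBody.GroundStateFeynmanKacDisplacement
import Literature.MathematicalPhysics.QuantumManyBody.OneParticleMarginals
import Literature.MathematicalPhysics.QuantumManyBody.BoseGasThermodynamicLimitRuelle
import Literature.MathematicalPhysics.QuantumManyBody.BoseGasDirichletWall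
import Mathlib.Probability.Distributions.Gaussian.Real
import Summits.AtomisticToContinuum.BoseEinsteinCondensation.Theorems.BECCutLineWeakDisorderTaggedShiftDisplacementTools
import Summits.AtomisticToContinuum.BoseEinsteinCondensation.Theorems.BECCutLineWeakDisorderWitnessTransferVanishStrongRepulsion
import HarnessLib

/-!
# Crux `TwoReplicaTransienceBound` (stmt-AtomisticToContinuum-9687), line `tagged-shift-log-harnack`:
# the Gaussian displacement constant and the free factorisation of a tagged-line functional

Support file (lead a1, from stub-worker W5). `lintegral_exp_mul_norm_displacement_le`
(`E[exp(c ‖√2 b_τ‖)] ≤ 6 e^{9c²τ}`, any line) and the free-gas factorisation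
`lintegral_fkWeight_free_mul_apply_zero` = registered toolbox stub `stub_freeTaggedFactorisation`:
for `v ≡ 0`, `∫dX₀ E_{X₀}[w_S Φ(ω 0)] = (one-line functional) × (bath mass)`
(`wienerPaths (n+1) ≅ wienerLine ⊗ wienerPaths n`, `fkWeight_vecCons_cons` at `v ≡ 0`, Tonelli).
[folklore]
-/


noncomputable section

open MeasureTheory ProbabilityTheory Filter Set Finset
open scoped ENNReal NNReal Topology BigOperators

namespace Summit.AtomisticToContinuum.BoseEinsteinCondensation.Cruxes.TwoReplicaTransienceBound.TaggedShiftLogHarnack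

open Literature.MathematicalPhysics.QuantumManyBody.BoseGas
open Literature.Probability.Process
open Summit.AtomisticToContinuum.BoseEinsteinCondensation.Theses.BECCutLineWeakDisorder

namespace TaggedDisplacement

variable {N : ℕ}

/-! ### The Gaussian constant `E[exp(c ‖√2 b_τ‖)] ≤ 6 e^{9c²τ}` -/

/-- One-dimensional Gaussian: `∫ e^{t|x|} dN(0, v) ≤ 2 e^{v t²/2}` (`e^{t|x|} ≤ e^{tx} + e^{-tx}` and
Mathlib's `mgf_id_gaussianReal`). -/
theorem lintegral_exp_mul_abs_gaussianReal_le (w : ℝ≥0) (t : ℝ) :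
    ∫⁻ x, ENNReal.ofReal (Real.exp (t * |x|)) ∂gaussianReal 0 w ≤
      ENNReal.ofReal (2 * Real.exp (w * t ^ 2 / 2)) := by
  have hmgf : ∀ r : ℝ, ∫⁻ x, ENNReal.ofReal (Real.exp (r * x)) ∂gaussianReal 0 w =
      ENNReal.ofReal (Real.exp (w * r ^ 2 / 2)) := by
    intro r
    rw [← ofReal_integral_eq_lintegral_ofReal (integrable_exp_mul_gaussianReal r)
      (ae_of_all _ fun x => (Real.exp_pos _).le)]
    have h := congr_fun (mgf_id_gaussianReal (μ := (0 : ℝ)) (v := w)) r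
    simp only [mgf, id, zero_mul, zero_add] at h
    rw [h]
  have hm : ∀ r : ℝ, Measurable fun x : ℝ => ENNReal.ofReal (Real.exp (r * x)) := fun r =>
    (measurable_id.const_mul r).exp.ennreal_ofReal
  calc ∫⁻ x, ENNReal.ofReal (Real.exp (t * |x|)) ∂gaussianReal 0 w
      ≤ ∫⁻ x, (ENNReal.ofReal (Real.exp (t * x)) + ENNReal.ofReal (Real.exp (-t * x)))
          ∂gaussianReal 0 w := by
        refine lintegral_mono fun x => ?_
        rw [← ENNReal.ofReal_add (Real.exp_pos _).le (Real.exp_pos _).le]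
        refine ENNReal.ofReal_le_ofReal ?_
        rcases abs_choice x with h | h
        · rw [h]; linarith [Real.exp_pos (-t * x)]
        · rw [h, show t * -x = -t * x by ring]; linarith [Real.exp_pos (t * x)]
    _ = ENNReal.ofReal (Real.exp (w * t ^ 2 / 2)) + ENNReal.ofReal (Real.exp (w * (-t) ^ 2 / 2)) := by
        rw [lintegral_add_left (hm t), hmgf t, hmgf (-t)]
    _ = ENNReal.ofReal (2 * Real.exp (w * t ^ 2 / 2)) := by
        rw [neg_sq, ← ENNReal.ofReal_add (Real.exp_pos _).le (Real.exp_pos _).le, two_mul]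

/-- **The Gaussian constant**: for `c ≥ 0`, `τ ≥ 0` and any line `i`,
`E[exp(c ‖√2 b_τ(ω i ·)‖)] ≤ 6 exp(9 c² τ)` (`‖·‖ ≤ ℓ¹`, `e^{A+B+C} ≤ Σ e^{3·}`, each coordinate
`√2 b_τ ~ N(0, 2τ)` by `map_sqrt_two_mul_brownian`, and `lintegral_exp_mul_abs_gaussianReal_le`). -/
theorem lintegral_exp_mul_norm_displacement_le (i : Fin N) {c : ℝ} (hc : 0 ≤ c) (τ : ℝ≥0) :
    ∫⁻ ω, ENNReal.ofReal (Real.exp (c * ‖displacement τ ω i‖)) ∂wienerPaths N ≤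
      ENNReal.ofReal (6 * Real.exp (9 * c ^ 2 * τ)) := by
  -- pointwise: `exp(c‖D i‖) ≤ Σ_k exp(3c |D i k|)`
  have hpt : ∀ ω : PathSpace N, ENNReal.ofReal (Real.exp (c * ‖displacement τ ω i‖)) ≤
      ∑ k : Fin 3, ENNReal.ofReal (Real.exp (3 * c * |Real.sqrt 2 * brownian τ (ω i k)|)) := by
    intro ω
    rw [← ENNReal.ofReal_sum_of_nonneg (fun k _ => (Real.exp_pos _).le)]
    refine ENNReal.ofReal_le_ofReal ?_
    have h1 : c * ‖displacement τ ω i‖ ≤ ∑ k : Fin 3, c * |displacement τ ω i k| := by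
      rw [← Finset.mul_sum]
      exact mul_le_mul_of_nonneg_left (Summit.AtomisticToContinuum.BoseEinsteinCondensation.Theorems.CutLineWitness.norm_le_sum_abs_space _) hc
    refine (Real.exp_le_exp.2 h1).trans ?_
    simp only [Fin.sum_univ_three, displacement_apply]
    -- `exp(A + B + C) ≤ e^{3A} + e^{3B} + e^{3C}` (the largest argument dominates)
    have h3 : ∀ A B C : ℝ,
        Real.exp (A + B + C) ≤ Real.exp (3 * A) + Real.exp (3 * B) + Real.exp (3 * C) := by
      intro A B C
      have hA := Real.exp_pos (3 * A)
      have hB := Real.exp_pos (3 * B)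
      have hC := Real.exp_pos (3 * C)
      rcases le_total A B with hAB | hAB <;> rcases le_total B C with hBC | hBC <;>
        rcases le_total A C with hAC | hAC
      all_goals first
        | (have h : A + B + C ≤ 3 * C := by linarith
           linarith [Real.exp_le_exp.2 h])
        | (have h : A + B + C ≤ 3 * B := by linarith
           linarith [Real.exp_le_exp.2 h])
        | (have h : A + B + C ≤ 3 * A := by linarith
           linarith [Real.exp_le_exp.2 h])
    have h := h3 (c * |Real.sqrt 2 * brownian τ (ω i 0)|)
      (c * |Real.sqrt 2 * brownian τ (ω i 1)|) (c * |Real.sqrt 2 * brownian τ (ω i 2)|)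
    simpa only [mul_assoc] using h
  -- each coordinate term is a one-dimensional Gaussian integral
  have hcoord : ∀ k : Fin 3,
      ∫⁻ ω, ENNReal.ofReal (Real.exp (3 * c * |Real.sqrt 2 * brownian τ (ω i k)|)) ∂wienerPaths N ≤
        ENNReal.ofReal (2 * Real.exp (9 * c ^ 2 * τ)) := by
    intro k
    have hf : Measurable fun x : ℝ => ENNReal.ofReal (Real.exp (3 * c * |x|)) :=
      (measurable_id.abs.const_mul (3 * c)).exp.ennreal_ofReal
    have hg : Measurable fun η : ℝ≥0 → ℝ => Real.sqrt 2 * brownian τ η :=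
      (measurable_brownian τ).const_mul _
    have h1 : ∫⁻ ω, ENNReal.ofReal (Real.exp (3 * c * |Real.sqrt 2 * brownian τ (ω i k)|))
        ∂wienerPaths N = ∫⁻ η, ENNReal.ofReal (Real.exp (3 * c * |Real.sqrt 2 * brownian τ η|))
        ∂preWienerMeasure :=
      (measurePreserving_apply₂ (N := N) i k).lintegral_comp (hf.comp hg)
    have h2 : ∫⁻ η, ENNReal.ofReal (Real.exp (3 * c * |Real.sqrt 2 * brownian τ η|))
        ∂preWienerMeasure = ∫⁻ x, ENNReal.ofReal (Real.exp (3 * c * |x|)) ∂gaussianReal 0 (2 * τ) := by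
      rw [← map_sqrt_two_mul_brownian τ, lintegral_map hf hg]
    rw [h1, h2]
    refine (lintegral_exp_mul_abs_gaussianReal_le (2 * τ) (3 * c)).trans (le_of_eq ?_)
    congr 2
    push_cast
    ring_nf
  have hmk : ∀ k : Fin 3, Measurable fun ω : PathSpace N =>
      ENNReal.ofReal (Real.exp (3 * c * |Real.sqrt 2 * brownian τ (ω i k)|)) := fun k =>
    ((((measurable_brownian τ).comp ((measurable_pi_apply k).comp (measurable_pi_apply i))).const_mul
      _).abs.const_mul _).exp.ennreal_ofReal
  calc ∫⁻ ω, ENNReal.ofReal (Real.exp (c * ‖displacement τ ω i‖)) ∂wienerPaths N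
      ≤ ∫⁻ ω, ∑ k : Fin 3, ENNReal.ofReal (Real.exp (3 * c * |Real.sqrt 2 * brownian τ (ω i k)|))
          ∂wienerPaths N := lintegral_mono hpt
    _ = ∑ k : Fin 3, ∫⁻ ω, ENNReal.ofReal (Real.exp (3 * c * |Real.sqrt 2 * brownian τ (ω i k)|))
          ∂wienerPaths N := lintegral_finsetSum _ fun k _ => hmk k
    _ ≤ ∑ _k : Fin 3, ENNReal.ofReal (2 * Real.exp (9 * c ^ 2 * τ)) :=
        Finset.sum_le_sum fun k _ => hcoord k
    _ = ENNReal.ofReal (6 * Real.exp (9 * c ^ 2 * τ)) := by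
        rw [Finset.sum_const, Finset.card_univ, Fintype.card_fin, nsmul_eq_mul, Nat.cast_ofNat,
          ← ENNReal.ofReal_ofNat 3, ← ENNReal.ofReal_mul (by norm_num)]
        congr 1
        ring

/-! ### Free gas: factorising a functional of the tagged line off the bath -/

open Summit.AtomisticToContinuum.BoseEinsteinCondensation.Cruxes.TwoReplicaTransienceBound.TracerDecoupling
open Summit.AtomisticToContinuum.BoseEinsteinCondensation.Cruxes.TwoReplicaTransienceBound.TracerDecoupling.TracerFactorisation

/-- One line, any `v`: the Feynman–Kac weight is the survival indicator (no pair interaction). -/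
theorem fkWeight_config_one (v : ℝ → ℝ≥0∞) (L S : ℝ) (X : Config 1) (ω : PathSpace 1) :
    fkWeight v L S X ω = (survives L S X).indicator (fun _ => (1 : ℝ≥0∞)) ω := by
  simp only [fkWeight, FreeGas.pathAction_config_one, expNeg_zero]

/-- **Free factorisation of a tagged-line functional**: for the free gas, every `n`, `L`, `S` and
every measurable `Φ ≥ 0` of the tagged coordinates,
`∫dX₀ E_{X₀}[w^{(n+1)}_S · Φ(ω 0)] = (∫dx ∫ w^{(1)}_S(x, ω₀) Φ(ω₀) dW(ω₀)) · ∫dY E_Y[w^{(n)}_S]`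
(`wienerPaths (n+1) ≅ wienerLine ⊗ wienerPaths n` along `Fin.cons`, `fkWeight_vecCons_cons` at
`v ≡ 0`, Tonelli). -/
theorem lintegral_fkWeight_free_mul_apply_zero (n : ℕ) (L S : ℝ) {Φ : (Fin 3 → (ℝ≥0 → ℝ)) → ℝ≥0∞}
    (hΦ : Measurable Φ) :
    ∫⁻ X₀ : Config (n + 1), ∫⁻ ω, fkWeight (fun _ => 0) L S X₀ ω * Φ (ω 0) ∂wienerPaths (n + 1) =
      (∫⁻ x : Space, ∫⁻ ω₀, fkWeight (N := 1) (fun _ => 0) L S (fun _ => x) (fun _ => ω₀) * Φ ω₀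
        ∂wienerLine) *
        ∫⁻ Y : Config n, ∫⁻ ωb, fkWeight (fun _ => 0) L S Y ωb ∂wienerPaths n := by
  have hv : Measurable (fun _ : ℝ => (0 : ℝ≥0∞)) := measurable_const
  set e := MeasurableEquiv.piFinSuccAbove (fun _ : Fin (n + 1) => Fin 3 → (ℝ≥0 → ℝ)) 0 with he
  have hmp : MeasurePreserving e (wienerPaths (n + 1)) (wienerLine.prod (wienerPaths n)) :=
    measurePreserving_piFinSuccAbove_wienerPaths n
  -- the tagged factor `g x ω₀ = w^{(1)}_S(x, ω₀) Φ(ω₀)` and its measurability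
  have hι : Measurable fun p : Space × (Fin 3 → (ℝ≥0 → ℝ)) =>
      ((fun _ : Fin 1 => p.1 : Config 1), (fun _ : Fin 1 => p.2 : PathSpace 1)) :=
    (measurable_pi_lambda _ fun _ => measurable_fst).prodMk (measurable_pi_lambda _ fun _ => measurable_snd)
  have hg2' := ((measurable_fkWeight_uncurry (N := 1) hv L S).comp hι).mul (hΦ.comp measurable_snd)
  have hg2 : Measurable fun p : Space × (Fin 3 → (ℝ≥0 → ℝ)) =>
      fkWeight (N := 1) (fun _ => 0) L S (fun _ => p.1) (fun _ => p.2) * Φ p.2 := hg2'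
  have hg : Measurable fun x : Space => ∫⁻ ω₀, fkWeight (N := 1) (fun _ => 0) L S (fun _ => x)
      (fun _ => ω₀) * Φ ω₀ ∂wienerLine := hg2.lintegral_prod_right'
  have hZb : Measurable fun Y : Config n => ∫⁻ ωb, fkWeight (fun _ => 0) L S Y ωb ∂wienerPaths n :=
    (measurable_fkWeight_uncurry hv L S).lintegral_prod_right'
  -- inner integral for fixed `x :: Y`
  have hinner : ∀ (x : Space) (Y : Config n),
      ∫⁻ ω, fkWeight (fun _ => 0) L S (Matrix.vecCons x Y) ω * Φ (ω 0) ∂wienerPaths (n + 1) =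
        (∫⁻ ω₀, fkWeight (N := 1) (fun _ => 0) L S (fun _ => x) (fun _ => ω₀) * Φ ω₀ ∂wienerLine) *
          ∫⁻ ωb, fkWeight (fun _ => 0) L S Y ωb ∂wienerPaths n := by
    intro x Y
    have hF : Measurable fun p : (Fin 3 → (ℝ≥0 → ℝ)) × PathSpace n =>
        fkWeight (fun _ => 0) L S (Matrix.vecCons x Y) (e.symm p) * Φ ((e.symm p) 0) :=
      ((measurable_fkWeight hv L S _).comp e.symm.measurable).mul
        (hΦ.comp ((measurable_pi_apply 0).comp e.symm.measurable))
    have hxω : Measurable fun ω₀ : Fin 3 → (ℝ≥0 → ℝ) => (x, ω₀) :=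
      measurable_const.prodMk measurable_id
    have hgx' := hg2.comp hxω
    have hgx : Measurable fun ω₀ : Fin 3 → (ℝ≥0 → ℝ) =>
        fkWeight (N := 1) (fun _ => 0) L S (fun _ => x) (fun _ => ω₀) * Φ ω₀ := hgx'
    -- pointwise factorisation of the integrand along `Fin.cons`
    have hpt : ∀ (ω₀ : Fin 3 → (ℝ≥0 → ℝ)) (ωb : PathSpace n),
        fkWeight (fun _ => 0) L S (Matrix.vecCons x Y) (e.symm (ω₀, ωb)) * Φ ((e.symm (ω₀, ωb)) 0) =
          (fkWeight (N := 1) (fun _ => 0) L S (fun _ => x) (fun _ => ω₀) * Φ ω₀) *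
            fkWeight (fun _ => 0) L S Y ωb := by
      intro ω₀ ωb
      have h1 : e.symm (ω₀, ωb) = Fin.cons ω₀ ωb := piFinSuccAbove_symm_apply_eq_cons n (ω₀, ωb)
      rw [h1, fkWeight_vecCons_cons hv L S x Y ω₀ ωb, Fin.cons_zero, taggedBathAction_zero,
        expNeg_zero, mul_one, fkWeight_config_one (fun _ => 0) L S (fun _ => x) (fun _ => ω₀)]
      ring
    rw [← hmp.symm.lintegral_comp_emb e.symm.measurableEmbedding, lintegral_prod _ hF.aemeasurable]
    calc ∫⁻ ω₀, ∫⁻ ωb, fkWeight (fun _ => 0) L S (Matrix.vecCons x Y) (e.symm (ω₀, ωb)) *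
            Φ ((e.symm (ω₀, ωb)) 0) ∂wienerPaths n ∂wienerLine
        = ∫⁻ ω₀, ∫⁻ ωb, (fkWeight (N := 1) (fun _ => 0) L S (fun _ => x) (fun _ => ω₀) * Φ ω₀) *
            fkWeight (fun _ => 0) L S Y ωb ∂wienerPaths n ∂wienerLine := by
          simp only [hpt]
      _ = ∫⁻ ω₀, (fkWeight (N := 1) (fun _ => 0) L S (fun _ => x) (fun _ => ω₀) * Φ ω₀) *
            ∫⁻ ωb, fkWeight (fun _ => 0) L S Y ωb ∂wienerPaths n ∂wienerLine :=
          lintegral_congr fun ω₀ => lintegral_const_mul _ (measurable_fkWeight hv L S Y)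
      _ = _ := lintegral_mul_const _ hgx
  -- integrate over `X₀ = x :: Y`
  have hX : Measurable fun X₀ : Config (n + 1) => ∫⁻ ω, fkWeight (fun _ => 0) L S X₀ ω * Φ (ω 0)
      ∂wienerPaths (n + 1) :=
    ((measurable_fkWeight_uncurry hv L S).mul
      (hΦ.comp ((measurable_pi_apply 0).comp measurable_snd))).lintegral_prod_right'
  rw [← lintegral_lintegral_vecCons hX]
  simp_rw [hinner]
  exact lintegral_lintegral_mul hg.aemeasurable hZb.aemeasurable

/-- `(ℝ³)¹ ≅ ℝ³`, `((ℝ≥0 → ℝ)³)¹ ≅ (ℝ≥0 → ℝ)³`: a tagged-line functional under `wienerPaths 1` in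
the one-line form. -/
theorem lintegral_config_one_pathSpace_one (L S : ℝ) (Φ : (Fin 3 → (ℝ≥0 → ℝ)) → ℝ≥0∞) :
    ∫⁻ X : Config 1, ∫⁻ ω, fkWeight (fun _ => 0) L S X ω * Φ (ω 0) ∂wienerPaths 1 =
      ∫⁻ x : Space, ∫⁻ ω₀, fkWeight (N := 1) (fun _ => 0) L S (fun _ => x) (fun _ => ω₀) * Φ ω₀
        ∂wienerLine := by
  rw [FreeGas.lintegral_config_one]
  refine lintegral_congr fun x => ?_
  have hmp := measurePreserving_funUnique wienerLine (Fin 1)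
  have hfun : ∀ ω : PathSpace 1, (fun _ : Fin 1 => (MeasurableEquiv.funUnique (Fin 1) _) ω) = ω :=
    fun ω => funext fun i => by rw [MeasurableEquiv.funUnique_apply, Subsingleton.elim i default]
  have h0 : ∀ ω : PathSpace 1, (MeasurableEquiv.funUnique (Fin 1) _) ω = ω 0 := fun ω => by
    rw [MeasurableEquiv.funUnique_apply, Subsingleton.elim (default : Fin 1) 0]
  calc ∫⁻ ω, fkWeight (fun _ => 0) L S (fun _ => x) ω * Φ (ω 0) ∂wienerPaths 1
      = ∫⁻ ω, fkWeight (N := 1) (fun _ => 0) L S (fun _ => x)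
          (fun _ => (MeasurableEquiv.funUnique (Fin 1) _) ω) *
          Φ ((MeasurableEquiv.funUnique (Fin 1) _) ω) ∂(Measure.pi fun _ : Fin 1 => wienerLine) := by
        rw [FreeGas.wienerPaths_one_eq]
        exact lintegral_congr fun ω => by rw [hfun, h0]
    _ = ∫⁻ ω₀, fkWeight (N := 1) (fun _ => 0) L S (fun _ => x) (fun _ => ω₀) * Φ ω₀ ∂wienerLine :=
        hmp.lintegral_comp_emb (MeasurableEquiv.measurableEmbedding _)
          (fun ω₀ => fkWeight (N := 1) (fun _ => 0) L S (fun _ => x) (fun _ => ω₀) * Φ ω₀)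

/-- Registered toolbox stub `stub_freeTaggedFactorisation` (lead a1, from worker W5): for the free
gas a functional of the tagged line's paths factorises off the bath under the flat-datum bridge. -/
theorem stub_freeTaggedFactorisation : ∀ (n : ℕ) (L S : ℝ) (Φ : (Fin 3 → (ℝ≥0 → ℝ)) → ℝ≥0∞), Measurable Φ →
    ∫⁻ X₀ : Config (n + 1), ∫⁻ ω, fkWeight (fun _ => 0) L S X₀ ω * Φ (ω 0) ∂wienerPaths (n + 1) =
      (∫⁻ x : Space, ∫⁻ ω₀, fkWeight (N := 1) (fun _ => 0) L S (fun _ => x) (fun _ => ω₀) * Φ ω₀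
        ∂wienerLine) *
        ∫⁻ Y : Config n, ∫⁻ ωb, fkWeight (fun _ => 0) L S Y ωb ∂wienerPaths n :=
  fun n L S _ hΦ => lintegral_fkWeight_free_mul_apply_zero n L S hΦ

end TaggedDisplacement

end Summit.AtomisticToContinuum.BoseEinsteinCondensation.Cruxes.TwoReplicaTransienceBound.TaggedShiftLogHarnack

end
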